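import Summits.BirchSwinnertonDyer.BirchSwinnertonDyer.Theorems.GenusKolyvaginAtTwoPowDvdShaCardAtTwoRTLocalKernelOneBitLocal
import Summits.BirchSwinnertonDyer.BirchSwinnertonDyer.Theorems.GenusKolyvaginAtTwoPowDvdShaCardAtTwoRTLocalKernelQuadraticDescent
import HarnessLib

/-!
# Route `GenusKolyvaginAtTwo`, LINE 18 / LINE 19 (L_T stmt-BirchSwinnertonDyer-23242, L⁺_T stmt-23379), critic #179
# price (1) at the SELMER LEVEL: the `d_K`-relaxed local condition contains the strict one with index `≤ #W_{v,K}`,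
# hence `≤ #E(ℚ_v)[2] = 2^{i_v}` at a quadratic place `w ∣ v ∤ 2`, and the relaxations at finitely many places cost at
# most the product

Seat `bsd-line-gk2-p3` g17 (cell `bsd-f1-sign2`), `--supports stmt-BirchSwinnertonDyer-23242` (helper; closes nothing).
THEOREMS ONLY (no definition, no named fact, no `sorry`); BSD is not proved by any of this.

The (+)-descent of LINE 18 v3/v4 (`stub_twinLadderDefect`: `2M₀ ≤ ord₂ g + ord₂ g' + Σ_{v ∣ d_K∞} i_v − 1`) reads
McCallum's ladder over `ℚ` in Selmer groups RELAXED at the primes `p ∣ d_K`: a class descended from the Heegner field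
`K` satisfies at `p` only the `K_𝔭`-local condition (`selmerLocalKer E (w.adicCompletion K) n`), not the `ℚ_p`-local
one (`selmerLocalKer E (v.adicCompletion ℚ) n`).  g16's `…LocalKernelQuadraticDescent` shows the two coincide when
Matsuno's `W_{v,K} = ker(H¹(ℚ_v, E) → H¹(K_w, E))` vanishes; this file gives the general count:

* §1 `relIndex_le_natCard_of_forall_mem` — abstract: for `f : A → B`, subgroups `H' , H ≤ A` with
  `(c ∈ H' ↔ f c = 0)` on `H` and `f(H) ⊆ V`, `V` finite: `[H : H' ∩ H] ≤ #V`.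
* §2 `relIndex_localRestrictionKer_le_natCard_localKernel` (torsor level) and
  `relIndex_selmerLocalKer_le_natCard_localKernel` (level `n`): for `E/ℚ`, `K`, `w ∣ v` finite, the `ℚ_v`-local
  condition has index `≤ #W_{v,K}` in the `K_w`-local condition (restriction `H¹(ℚ, E) → H¹(ℚ_v, E)` maps the latter
  into `W_{v,K}` with kernel the former — `mem_localRestrictionKer_iff_resBaseChange_mem`, `mem_ker_resBaseChange_iff`).
* §3 `relIndex_selmerLocalKer_le_natCard_twoTorsion` — **at a quadratic place `w ∣ v ∤ 2` the `d_K`-relaxation of the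
  level-`n` Selmer condition costs at most `log₂ #E(ℚ_v)[2] = i_v` bits** (one-bit bound
  `natCard_localKernel_le_natCard_twoTorsion`, sibling file `…LocalKernelOneBitLocal`); torsor level alike.
* §4 `relIndex_inf_iInf_le_prod` — abstract bookkeeping for finitely many relaxed places: for `C ≤ A` and families
  `H' i ≤ H i` (`i ∈ ι` finite), `[C ⊓ ⨅ H i : C ⊓ ⨅ H' i] ≤ ∏ [H i : H' i]`; so a Selmer group relaxed at the places
  over `d_K` contains the strict one with index `≤ ∏_{p ∣ d_K} #W_{p,K} ≤ 2^{Σ i_p}` — the genus budget of #179.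

References: [Kramer1981] §2 Prop. 3, §3; [Matsuno2009] §3 (W_{v,K}), Prop. 3.2 (the same snake-lemma bookkeeping);
[MazurRubin2010] Lemma 2.2, Prop. 3.3 (local conditions at T-primes); [SilvermanAEC2009] X.§4.
-/

set_option autoImplicit false
-- the Theorems namespace of this sub repeats the summit name by design (D-0017 nested layout)
set_option linter.dupNamespace false

noncomputable section

open scoped Classical

namespace Summit.BirchSwinnertonDyer.BirchSwinnertonDyer.Theorems.GenusExact.PlusDescent

open WeierstrassCurve NumberField IsDedekindDomain Literature.NumberTheory.EllipticCurves
  Literature.Barriers.BirchSwinnertonDyer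

universe u

/-! ## §1 Abstract: the index of `H ∩ f⁻¹(0)` in `H` is at most `#f(H)` -/

section Abstract

variable {A B : Type*} [AddCommGroup A] [AddCommGroup B]

/-- **`[H : H' ∩ H] ≤ #V`** when, on `H`, membership in `H'` means `f c = 0` and `f(H) ⊆ V` with `V` finite: the
restriction of `f` to `H` has kernel `H' ∩ H` and lands in `V`, so `H/(H' ∩ H) ≅ f(H) ≤ V`. [folklore] -/
theorem relIndex_le_natCard_of_forall_mem (f : A →+ B) (H' H : AddSubgroup A) (V : AddSubgroup B) [Finite V]
    (hH' : ∀ c ∈ H, c ∈ H' ↔ f c = 0) (hV : ∀ c ∈ H, f c ∈ V) : H'.relIndex H ≤ Nat.card V := by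
  let g : H →+ V := AddMonoidHom.codRestrict (f.comp H.subtype) V fun c ↦ hV c c.2
  have hker : g.ker = H'.addSubgroupOf H := by
    ext c
    rw [AddMonoidHom.mem_ker, AddSubgroup.mem_addSubgroupOf, hH' c c.2]
    constructor
    · intro h; exact congrArg Subtype.val h
    · intro h; exact Subtype.ext h
  rw [AddSubgroup.relIndex, ← hker, AddSubgroup.index_ker]
  exact AddSubgroup.card_le_card_addGroup _

/-- **`[C ⊓ ⨅ H i : C ⊓ ⨅ H' i] ≤ ∏ [H i : H' i ∩ H i]`** for families `H' i`, `H i` with each relative index finite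
(`i ∈ ι` finite) and any `C`: the quotient embeds into `∏ H i / (H' i ∩ H i)` (Mathlib `relIndex_iInf_le`,
`relIndex_le_of_le_right`).  Bookkeeping for a
Selmer group relaxed at finitely many places (`C` = the conditions at the other places). [folklore] -/
theorem relIndex_inf_iInf_le_prod {ι : Type*} [Fintype ι] (C : AddSubgroup A) (H' H : ι → AddSubgroup A)
    (hfin : ∀ i, (H' i).relIndex (H i) ≠ 0) :
    (C ⊓ ⨅ i, H' i).relIndex (C ⊓ ⨅ i, H i) ≤ ∏ i, (H' i).relIndex (H i) := by
  set L : AddSubgroup A := C ⊓ ⨅ i, H i with hL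
  have hLC : L ≤ C := inf_le_left
  have hLH : ∀ i, L ≤ H i := fun i ↦ inf_le_right.trans (iInf_le _ i)
  -- `(C ⊓ X).relIndex L = X.relIndex L` since `L ≤ C`
  have h1 : (C ⊓ ⨅ i, H' i).relIndex L = (⨅ i, H' i).relIndex L := by
    rw [← AddSubgroup.inf_relIndex_right (C ⊓ ⨅ i, H' i), ← AddSubgroup.inf_relIndex_right (⨅ i, H' i)]
    congr 1
    apply le_antisymm
    · exact le_inf (inf_le_left.trans inf_le_right) inf_le_right
    · exact le_inf (le_inf (inf_le_right.trans hLC) inf_le_left) inf_le_right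
  rw [h1]
  refine (AddSubgroup.relIndex_iInf_le H').trans (Finset.prod_le_prod' fun i _ ↦ ?_)
  exact AddSubgroup.relIndex_le_of_le_right (hLH i) (hfin i)

end Abstract

/-! ## §2 The `ℚ_v`-local condition inside the `K_w`-local condition: index `≤ #W_{v,K}` -/

section Local

variable (E : WeierstrassCurve ℚ) (K : Type) [Field K] [NumberField K] (v : HeightOneSpectrum (𝓞 ℚ))
  (w : HeightOneSpectrum (𝓞 K)) [w.asIdeal.LiesOver v.asIdeal]

/-- **Torsor level: `[ker(H¹(ℚ,E) → H¹(K_w,E)) : ker(H¹(ℚ,E) → H¹(ℚ_v,E))] ≤ #W_{v,K}`** (when `W_{v,K}` is finite): the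
restriction `H¹(ℚ, E) → H¹(ℚ_v, E)` (`resBaseChange`) maps the classes dying in `H¹(K_w, E)` into Matsuno's
`W_{v,K} = ker(H¹(ℚ_v, E) → H¹(K_w, E))` (`mem_localRestrictionKer_iff_resBaseChange_mem`), with kernel the classes
dying in `H¹(ℚ_v, E)` (`mem_ker_resBaseChange_iff`).  Matsuno 2009, proof of Prop. 3.2 (the same diagram).
[cite: Matsuno2009, §3 (p. 451, W_{v,K}) and Prop. 3.2] -/
theorem relIndex_localRestrictionKer_le_natCard_localKernel [Finite (Matsuno2009.localKernel E K v w)] :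
    (E.localRestrictionKer (v.adicCompletion ℚ)).relIndex (E.localRestrictionKer (w.adicCompletion K)) ≤
      Nat.card (Matsuno2009.localKernel E K v w) := by
  letI : Algebra (v.adicCompletion ℚ) (w.adicCompletion K) :=
    (Literature.NumberTheory.EllipticCurves.adicCompletionMap (K := ℚ) K v w).toAlgebra
  haveI : IsScalarTower ℚ (v.adicCompletion ℚ) (w.adicCompletion K) :=
    IsScalarTower.of_algebraMap_eq fun x ↦
      (Literature.NumberTheory.EllipticCurves.adicCompletionMap_coe (K := ℚ) K v w x).symm
  refine relIndex_le_natCard_of_forall_mem (resBaseChange E (v.adicCompletion ℚ)) _ _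
    (Matsuno2009.localKernel E K v w) (fun c _ ↦ (mem_ker_resBaseChange_iff E (v.adicCompletion ℚ) c).symm)
    fun c hc ↦ ?_
  have h := (mem_localRestrictionKer_iff_resBaseChange_mem E (L := v.adicCompletion ℚ)
    (E' := w.adicCompletion K) c).mp hc
  exact h

/-- **Level `n`: `[K_w-local condition : ℚ_v-local condition] ≤ #W_{v,K}` on `H¹(ℚ, E[n])`** (when `W_{v,K}` is finite):
the level-`n` conditions `selmerLocalKer E (w.adicCompletion K) n ⊇ selmerLocalKer E (v.adicCompletion ℚ) n` are the
preimages of the torsor-level ones under `H¹(ℚ, E[n]) → H¹(ℚ, E)` (`mem_selmerLocalKer_iff_torsionH1ToH1_mem`), so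
§1 applies to `resBaseChange ∘ torsionH1ToH1`.  This is the count behind critic #179's «a descended class is only
norm-locally trivial at `p ∣ d_K`»: the `d_K`-relaxed Selmer condition at `p` exceeds the strict one by at most
`log₂ #W_{p,K}` bits. [cite: Matsuno2009, §3 (p. 451, W_{v,K}) and Prop. 3.2] [cite: SilvermanAEC2009, X.§4] -/
theorem relIndex_selmerLocalKer_le_natCard_localKernel [Finite (Matsuno2009.localKernel E K v w)] (n : ℤ) :
    (selmerLocalKer E (v.adicCompletion ℚ) n).relIndex (selmerLocalKer E (w.adicCompletion K) n) ≤
      Nat.card (Matsuno2009.localKernel E K v w) := by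
  letI : Algebra (v.adicCompletion ℚ) (w.adicCompletion K) :=
    (Literature.NumberTheory.EllipticCurves.adicCompletionMap (K := ℚ) K v w).toAlgebra
  haveI : IsScalarTower ℚ (v.adicCompletion ℚ) (w.adicCompletion K) :=
    IsScalarTower.of_algebraMap_eq fun x ↦
      (Literature.NumberTheory.EllipticCurves.adicCompletionMap_coe (K := ℚ) K v w x).symm
  refine relIndex_le_natCard_of_forall_mem ((resBaseChange E (v.adicCompletion ℚ)).comp (torsionH1ToH1 E n)) _ _
    (Matsuno2009.localKernel E K v w) (fun c _ ↦ ?_) fun c hc ↦ ?_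
  · rw [WeierstrassCurve.mem_selmerLocalKer_iff_torsionH1ToH1_mem, AddMonoidHom.comp_apply,
      mem_ker_resBaseChange_iff]
  · rw [WeierstrassCurve.mem_selmerLocalKer_iff_torsionH1ToH1_mem] at hc
    exact (mem_localRestrictionKer_iff_resBaseChange_mem E (L := v.adicCompletion ℚ)
      (E' := w.adicCompletion K) _).mp hc

end Local

/-! ## §3 At a quadratic place `w ∣ v ∤ 2`: the relaxation costs at most `i_v = log₂ #E(ℚ_v)[2]` bits -/

section Quadratic

variable (E : WeierstrassCurve ℚ) [E.IsElliptic] (K : Type) [Field K] [NumberField K]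
  (v : HeightOneSpectrum (𝓞 ℚ)) (w : HeightOneSpectrum (𝓞 K)) [w.asIdeal.LiesOver v.asIdeal]

/-- **THE `d_K`-RELAXATION OF THE LEVEL-`n` SELMER CONDITION COSTS AT MOST `i_v` BITS** (critic #179 price (1), the
locus count): for `E/ℚ` elliptic, `w ∣ v` finite with `[K_w : ℚ_v] = 2` and `w ∤ 2`, and every level `n`,
`[selmerLocalKer E K_w n : selmerLocalKer E ℚ_v n] ≤ #E(ℚ_v)[2]` — at a ramified odd prime `p ∣ d_K` of good reduction
`#E(ℚ_p)[2] = #Ẽ(𝔽_p)[2] = 2^{i_p}`: `0` bits at `a_p` odd, `≤ 1` at a transposition prime, `≤ 2` when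
`E[2] ⊆ E(ℚ_p)`.  §2 with the one-bit bound `natCard_localKernel_le_natCard_twoTorsion` (Kramer 1981 Prop. 3).
[cite: Kramer1981, §2 Prop. 3] [cite: Matsuno2009, §3 and Prop. 3.2] -/
theorem relIndex_selmerLocalKer_le_natCard_twoTorsion
    (h2 : letI : Algebra (v.adicCompletion ℚ) (w.adicCompletion K) :=
        (Literature.NumberTheory.EllipticCurves.adicCompletionMap (K := ℚ) K v w).toAlgebra
      Module.finrank (v.adicCompletion ℚ) (w.adicCompletion K) = 2)
    (hw : ((2 : ℕ) : 𝓞 K) ∉ w.asIdeal) (n : ℤ) :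
    (selmerLocalKer E (v.adicCompletion ℚ) n).relIndex (selmerLocalKer E (w.adicCompletion K) n) ≤
      Nat.card {P : (E.baseChange (v.adicCompletion ℚ)).toAffine.Point // 2 • P = 0} := by
  obtain ⟨hfin, hle⟩ := natCard_localKernel_le_natCard_twoTorsion E K v w h2 hw
  haveI := hfin
  exact (relIndex_selmerLocalKer_le_natCard_localKernel E K v w n).trans hle

/-- The torsor-level form of `relIndex_selmerLocalKer_le_natCard_twoTorsion`:
`[ker(H¹(ℚ,E) → H¹(K_w,E)) : ker(H¹(ℚ,E) → H¹(ℚ_v,E))] ≤ #E(ℚ_v)[2]` at a quadratic place `w ∣ v ∤ 2`.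
[cite: Kramer1981, §2 Prop. 3] [cite: Matsuno2009, §3 and Prop. 3.2] -/
theorem relIndex_localRestrictionKer_le_natCard_twoTorsion
    (h2 : letI : Algebra (v.adicCompletion ℚ) (w.adicCompletion K) :=
        (Literature.NumberTheory.EllipticCurves.adicCompletionMap (K := ℚ) K v w).toAlgebra
      Module.finrank (v.adicCompletion ℚ) (w.adicCompletion K) = 2)
    (hw : ((2 : ℕ) : 𝓞 K) ∉ w.asIdeal) :
    (E.localRestrictionKer (v.adicCompletion ℚ)).relIndex (E.localRestrictionKer (w.adicCompletion K)) ≤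
      Nat.card {P : (E.baseChange (v.adicCompletion ℚ)).toAffine.Point // 2 • P = 0} := by
  obtain ⟨hfin, hle⟩ := natCard_localKernel_le_natCard_twoTorsion E K v w h2 hw
  haveI := hfin
  exact (relIndex_localRestrictionKer_le_natCard_localKernel E K v w).trans hle

/-- **Finite, non-zero index**: at a quadratic place `w ∣ v ∤ 2` the `ℚ_v`-local condition has finite index in the
`K_w`-local one (needed to feed `relIndex_inf_iInf_le_prod`). [cite: Kramer1981, §2 Prop. 3] -/
theorem relIndex_selmerLocalKer_ne_zero
    (h2 : letI : Algebra (v.adicCompletion ℚ) (w.adicCompletion K) :=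
        (Literature.NumberTheory.EllipticCurves.adicCompletionMap (K := ℚ) K v w).toAlgebra
      Module.finrank (v.adicCompletion ℚ) (w.adicCompletion K) = 2)
    (hw : ((2 : ℕ) : 𝓞 K) ∉ w.asIdeal) (n : ℤ) :
    (selmerLocalKer E (v.adicCompletion ℚ) n).relIndex (selmerLocalKer E (w.adicCompletion K) n) ≠ 0 := by
  letI : Algebra (v.adicCompletion ℚ) (w.adicCompletion K) :=
    (Literature.NumberTheory.EllipticCurves.adicCompletionMap (K := ℚ) K v w).toAlgebra
  haveI : IsScalarTower ℚ (v.adicCompletion ℚ) (w.adicCompletion K) :=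
    IsScalarTower.of_algebraMap_eq fun x ↦
      (Literature.NumberTheory.EllipticCurves.adicCompletionMap_coe (K := ℚ) K v w x).symm
  obtain ⟨hfin, -⟩ := natCard_localKernel_le_natCard_twoTorsion E K v w h2 hw
  haveI := hfin
  -- the quotient embeds into the finite `W_{v,K}` (§1–§2), so the index is the cardinality of a finite type
  set H : AddSubgroup (galH1Torsion E n) := selmerLocalKer E (w.adicCompletion K) n with hH
  set H' : AddSubgroup (galH1Torsion E n) := selmerLocalKer E (v.adicCompletion ℚ) n with hH'
  let f : galH1Torsion E n →+ (E.baseChange (v.adicCompletion ℚ)).galH1 :=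
    (resBaseChange E (v.adicCompletion ℚ)).comp (torsionH1ToH1 E n)
  have hV : ∀ c ∈ H, f c ∈ Matsuno2009.localKernel E K v w := by
    intro c hc
    rw [hH, WeierstrassCurve.mem_selmerLocalKer_iff_torsionH1ToH1_mem] at hc
    exact (mem_localRestrictionKer_iff_resBaseChange_mem E (L := v.adicCompletion ℚ)
      (E' := w.adicCompletion K) _).mp hc
  let g : H →+ Matsuno2009.localKernel E K v w := AddMonoidHom.codRestrict (f.comp H.subtype) _ fun c ↦ hV c c.2
  have hker : g.ker = H'.addSubgroupOf H := by
    ext c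
    rw [AddMonoidHom.mem_ker, AddSubgroup.mem_addSubgroupOf, hH',
      WeierstrassCurve.mem_selmerLocalKer_iff_torsionH1ToH1_mem, ← mem_ker_resBaseChange_iff]
    constructor
    · intro h; exact congrArg Subtype.val h
    · intro h; exact Subtype.ext h
  rw [AddSubgroup.relIndex, ← hker, AddSubgroup.index_ker]
  exact Nat.card_pos.ne'

end Quadratic

end Summit.BirchSwinnertonDyer.BirchSwinnertonDyer.Theorems.GenusExact.PlusDescent

end
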